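import Summits.AtomisticToContinuum.BoseEinsteinCondensation.Theorems.PuffFloor.Negative.PairCorrelationToolkit
import Literature.MathematicalPhysics.QuantumManyBody.BoseGasDirichletWall
import Literature.MathematicalPhysics.QuantumManyBody.GroundStateDirichletForm
import HarnessLib

/-!
# The anti-correlated witness `Ψ_ε ∝ √(1 - ε t_m)` (negative-side support for crux `PuffFloor`, stmt-AtomisticToContinuum-11785)

Second file of the refuter's negative-side chain for crux `PuffFloor` of route
`BECConjugateDomination`. For a mode `m ≠ 0`, side `L > 0` and an amplitude `0 ≤ ε` with
`ε(N² - N) ≤ ½`, the function `√g`, `g = 1 - ε t_m = 1 - ε(|ρ_m|² - N) ∈ [½, 1 + εN]`, is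
real, strictly positive, `C¹`, `Lℤ³`-periodic and Bose-symmetric, so `PeriodicTrialState.ofFun`
normalises it to an admissible periodic trial state `witnessState` (`ε = 0`: the constant state).

* `structureFactor_witnessState` — the crux's structure factor of the witness is EXACTLY
  `S_m(Ψ_ε) = N⁻¹ ∫_{Λᴺ} |ρ_m|² |Ψ_ε|² = 1 - ε(N - 1)` (from `∫ t_m = 0`, `∫ t_m² = N(N-1)(L³)ᴺ`):
  pair ANTI-correlation at mode `m` pushes `S_m` below `1`.
* `periodicEnergy_witnessState_le` — its free kinetic energy is at most `2 ε² N³ |k|²`,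
  `|k| = ‖(2π/L)•m‖` (pointwise `|∂_{i,a}Ψ_ε|² ≤ 2(L³)^{-N}ε²N²(2πmₐ/L)²` from
  `∂Ψ = c ∂g/(2√g)`, `|∂g| ≤ 2εN|∂ρ_m|`, `g ≥ ½`).

All `[folklore]`; no statement of the route is asserted here.
-/

noncomputable section

namespace Summit.AtomisticToContinuum.BoseEinsteinCondensation.Theorems.PuffFloor.Negative

open Literature.MathematicalPhysics.QuantumManyBody.BoseGas MeasureTheory Complex Finset
open scoped ComplexConjugate BigOperators ENNReal NNReal

variable {N : ℕ} {L : ℝ}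

/-! ### The anti-correlated witness `Ψ ∝ √(1 - ε t_m)` -/

/-- The witness density `g(X) = 1 - ε t_m(X)`; for `0 ≤ ε`, `ε(N² - N) ≤ ½` it lies in
`[½, 1 + εN]`. [folklore] -/
def witnessDensity (ε L : ℝ) (m : Fin 3 → ℤ) (X : Config N) : ℝ :=
  1 - ε * pairCorr L m X

/-- `½ ≤ g`. [folklore] -/
theorem half_le_witnessDensity {ε : ℝ} (hε : 0 ≤ ε) (hε' : ε * ((N : ℝ) ^ 2 - N) ≤ 1 / 2)
    (L : ℝ) (m : Fin 3 → ℤ) (X : Config N) : 1 / 2 ≤ witnessDensity ε L m X := by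
  unfold witnessDensity
  have h1 : ε * pairCorr L m X ≤ ε * ((N : ℝ) ^ 2 - N) :=
    mul_le_mul_of_nonneg_left (pairCorr_le L m X) hε
  linarith

/-- `0 < g`. [folklore] -/
theorem witnessDensity_pos {ε : ℝ} (hε : 0 ≤ ε) (hε' : ε * ((N : ℝ) ^ 2 - N) ≤ 1 / 2)
    (L : ℝ) (m : Fin 3 → ℤ) (X : Config N) : 0 < witnessDensity ε L m X :=
  lt_of_lt_of_le (by norm_num) (half_le_witnessDensity hε hε' L m X)

/-- `g` is continuous. [folklore] -/
theorem continuous_witnessDensity (ε L : ℝ) (m : Fin 3 → ℤ) :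
    Continuous (witnessDensity (N := N) ε L m) :=
  continuous_const.sub (continuous_const.mul (continuous_pairCorr L m))

/-- `g` is `C¹`. [folklore] -/
theorem contDiff_witnessDensity (ε L : ℝ) (m : Fin 3 → ℤ) :
    ContDiff ℝ 1 (witnessDensity (N := N) ε L m) :=
  contDiff_const.sub (contDiff_const.mul (contDiff_pairCorr L m))

/-- The (unnormalised) witness wave function `√g`, real and strictly positive. [folklore] -/
def witnessFun (ε L : ℝ) (m : Fin 3 → ℤ) (X : Config N) : ℂ :=
  ((Real.sqrt (witnessDensity ε L m X) : ℝ) : ℂ)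

/-- `|√g| = √g`. [folklore] -/
theorem norm_witnessFun (ε L : ℝ) (m : Fin 3 → ℤ) (X : Config N) :
    ‖witnessFun ε L m X‖ = Real.sqrt (witnessDensity ε L m X) := by
  rw [witnessFun, Complex.norm_real, Real.norm_of_nonneg (Real.sqrt_nonneg _)]

section Witness

variable {ε : ℝ} (hε : 0 ≤ ε) (hε' : ε * ((N : ℝ) ^ 2 - N) ≤ 1 / 2)
include hε hε'

/-- `|√g|² = g`. [folklore] -/
theorem norm_sq_witnessFun (L : ℝ) (m : Fin 3 → ℤ) (X : Config N) :
    ‖witnessFun ε L m X‖ ^ 2 = witnessDensity ε L m X := by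
  rw [norm_witnessFun, Real.sq_sqrt (witnessDensity_pos hε hε' L m X).le]

/-- `√g` is `C¹` (`g > 0`). [folklore] -/
theorem contDiff_witnessFun (L : ℝ) (m : Fin 3 → ℤ) :
    ContDiff ℝ 1 (witnessFun (N := N) ε L m) := by
  unfold witnessFun
  refine Complex.ofRealCLM.contDiff.comp ?_
  exact (contDiff_witnessDensity ε L m).sqrt fun X => (witnessDensity_pos hε hε' L m X).ne'

omit hε hε' in
/-- `√g` is periodic. [folklore] -/
theorem witnessFun_periodic (hL : L ≠ 0) (m : Fin 3 → ℤ) (X : Config N) (i : Fin N) (a : Fin 3) :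
    witnessFun ε L m (X + Pi.single i (EuclideanSpace.single a L)) = witnessFun ε L m X := by
  simp only [witnessFun, witnessDensity, pairCorr_periodic hL]

omit hε hε' in
/-- `√g` is Bose-symmetric. [folklore] -/
theorem witnessFun_symm (L : ℝ) (m : Fin 3 → ℤ) (σ : Equiv.Perm (Fin N)) (X : Config N) :
    witnessFun ε L m (X ∘ σ) = witnessFun ε L m X := by
  simp only [witnessFun, witnessDensity, pairCorr_symm]

/-- `√g ≠ 0`. [folklore] -/
theorem witnessFun_ne_zero (L : ℝ) (m : Fin 3 → ℤ) (X : Config N) : witnessFun ε L m X ≠ 0 := by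
  rw [witnessFun, Complex.ofReal_ne_zero]
  exact (Real.sqrt_pos.2 (witnessDensity_pos hε hε' L m X)).ne'

omit hε hε' in
/-- `√g` is real. [folklore] -/
theorem witnessFun_real (L : ℝ) (m : Fin 3 → ℤ) (X : Config N) :
    witnessFun ε L m X = (‖witnessFun ε L m X‖ : ℂ) := by
  rw [norm_witnessFun, witnessFun]

omit hε hε' in
/-- `(L³)ᴺ` is the real volume of the cell. [folklore] -/
theorem measureReal_cellN (hL : 0 < L) (N : ℕ) :
    (volume : Measure (Config N)).real (cellN N L) = (L ^ 3) ^ N := by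
  rw [measureReal_def, volume_cellN, ENNReal.toReal_pow, ENNReal.toReal_pow,
    ENNReal.toReal_ofReal hL.le]

/-- `∫_{Λᴺ} |√g|² = ∫ g = L^{3N}` (the correction `t_m` has zero mean). [folklore] -/
theorem lintegral_witnessFun (hL : 0 < L) {m : Fin 3 → ℤ} (hm : m ≠ 0) :
    ∫⁻ X in cellN N L, ((‖witnessFun ε L m X‖₊ : ℝ≥0∞)) ^ 2 = ENNReal.ofReal ((L ^ 3) ^ N) := by
  simp_rw [coe_nnnorm_sq_eq_ofReal, norm_sq_witnessFun hε hε']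
  rw [← ofReal_integral_eq_lintegral_ofReal
    (integrableOn_cellN_real L (continuous_witnessDensity ε L m))
    (Filter.Eventually.of_forall fun X => (witnessDensity_pos hε hε' L m X).le)]
  congr 1
  unfold witnessDensity
  have hi1 : IntegrableOn (fun _ : Config N => (1 : ℝ)) (cellN N L) volume :=
    integrableOn_const (by
      rw [volume_cellN]; exact ENNReal.pow_ne_top (ENNReal.pow_ne_top ENNReal.ofReal_ne_top))
  have hi2 : IntegrableOn (fun X : Config N => ε * pairCorr L m X) (cellN N L)
      volume := (integrableOn_cellN_real L (continuous_pairCorr L m)).const_mul _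
  rw [integral_sub hi1 hi2, integral_const_mul, integral_cellN_pairCorr hL hm, mul_zero, sub_zero,
    setIntegral_const, measureReal_cellN hL, smul_eq_mul, mul_one]

/-- **The witness state** `Ψ = √g / ‖√g‖` on the torus of side `L`: `C¹`, periodic, symmetric,
normalised, real and pointwise positive. [folklore] -/
def witnessState (hL : 0 < L) {m : Fin 3 → ℤ} (hm : m ≠ 0) : PeriodicTrialState N L :=
  PeriodicTrialState.ofFun (witnessFun ε L m) (contDiff_witnessFun hε hε' L m)
    (witnessFun_periodic hL.ne' m) (witnessFun_symm L m)
    (by rw [lintegral_witnessFun hε hε' hL hm]; exact (ENNReal.ofReal_pos.2 (by positivity)).ne')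
    (by rw [lintegral_witnessFun hε hε' hL hm]; exact ENNReal.ofReal_ne_top)

/-- The witness state is `(L³)^{-N/2} √g`. [folklore] -/
theorem witnessState_apply (hL : 0 < L) {m : Fin 3 → ℤ} (hm : m ≠ 0) (X : Config N) :
    (witnessState hε hε' hL hm).ψ X = ((Real.sqrt ((L ^ 3) ^ N))⁻¹ : ℂ) * witnessFun ε L m X := by
  rw [witnessState, PeriodicTrialState.ofFun_apply, lintegral_witnessFun hε hε' hL hm,
    ENNReal.toReal_ofReal (by positivity)]

/-- `|Ψ|² = (L³)^{-N} g`. [folklore] -/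
theorem norm_sq_witnessState (hL : 0 < L) {m : Fin 3 → ℤ} (hm : m ≠ 0) (X : Config N) :
    ‖(witnessState hε hε' hL hm).ψ X‖ ^ 2 = ((L ^ 3) ^ N)⁻¹ * witnessDensity ε L m X := by
  rw [witnessState_apply, norm_mul, mul_pow, norm_sq_witnessFun hε hε', norm_inv, Complex.norm_real,
    Real.norm_of_nonneg (Real.sqrt_nonneg _), inv_pow, Real.sq_sqrt (by positivity)]

/-- The witness state is real (`Ψ = |Ψ|`). [folklore] -/
theorem witnessState_real (hL : 0 < L) {m : Fin 3 → ℤ} (hm : m ≠ 0) (X : Config N) :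
    (witnessState hε hε' hL hm).ψ X = (‖(witnessState hε hε' hL hm).ψ X‖ : ℂ) := by
  rw [witnessState_apply, norm_mul, norm_inv, Complex.norm_real,
    Real.norm_of_nonneg (Real.sqrt_nonneg _), Complex.ofReal_mul, Complex.ofReal_inv,
    ← witnessFun_real]

/-- The witness state is pointwise non-zero. [folklore] -/
theorem witnessState_ne_zero (hL : 0 < L) {m : Fin 3 → ℤ} (hm : m ≠ 0) (X : Config N) :
    (witnessState hε hε' hL hm).ψ X ≠ 0 := by
  rw [witnessState_apply]
  refine mul_ne_zero ?_ (witnessFun_ne_zero hε hε' L m X)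
  rw [Ne, inv_eq_zero, Complex.ofReal_eq_zero]
  exact (Real.sqrt_pos.2 (by positivity)).ne'

/-- **The structure factor of the witness**: `S_m(Ψ) = 1 - ε(N-1)`. [folklore] -/
theorem structureFactor_witnessState (hL : 0 < L) (hN : 0 < N) {m : Fin 3 → ℤ} (hm : m ≠ 0) :
    (N : ℝ)⁻¹ * ∫ X in cellN N L,
        ‖∑ j : Fin N, cellWave L m (X j)‖ ^ 2 * ‖(witnessState hε hε' hL hm).ψ X‖ ^ 2 =
      1 - ε * ((N : ℝ) - 1) := by
  have hN' : (0 : ℝ) < N := by exact_mod_cast hN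
  have hV : (0 : ℝ) < (L ^ 3) ^ N := by positivity
  have hfun : (fun X : Config N =>
      ‖∑ j : Fin N, cellWave L m (X j)‖ ^ 2 * ‖(witnessState hε hε' hL hm).ψ X‖ ^ 2) =
      fun X => ((L ^ 3) ^ N)⁻¹ * ((N : ℝ) + (1 - ε * N) * pairCorr L m X - ε * pairCorr L m X ^ 2) := by
    funext X
    rw [norm_sq_witnessState hε hε']
    have : ‖∑ j : Fin N, cellWave L m (X j)‖ ^ 2 = pairCorr L m X + N := by
      rw [pairCorr, planeWaveSum]; ring
    rw [this, witnessDensity]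
    ring
  rw [hfun, integral_const_mul]
  have hi1 : IntegrableOn (fun _ : Config N => (N : ℝ)) (cellN N L) volume :=
    integrableOn_const (by
      rw [volume_cellN]; exact ENNReal.pow_ne_top (ENNReal.pow_ne_top ENNReal.ofReal_ne_top))
  have hi2 : IntegrableOn (fun X : Config N => (1 - ε * N) * pairCorr L m X) (cellN N L) volume :=
    (integrableOn_cellN_real L (continuous_pairCorr L m)).const_mul _
  have hi3 : IntegrableOn (fun X : Config N => ε * pairCorr L m X ^ 2) (cellN N L) volume :=
    (integrableOn_cellN_real L ((continuous_pairCorr L m).pow 2)).const_mul _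
  have hi12 : IntegrableOn (fun X : Config N => (N : ℝ) + (1 - ε * N) * pairCorr L m X) (cellN N L)
      volume := hi1.add hi2
  rw [integral_sub hi12 hi3, integral_add hi1 hi2, integral_const_mul, integral_const_mul,
    integral_cellN_pairCorr hL hm, integral_cellN_pairCorr_sq hL hm, setIntegral_const,
    measureReal_cellN hL, smul_eq_mul]
  field_simp
  ring

end Witness

/-! ### The kinetic energy of the witness: `E(Ψ_ε) ≤ 2 ε² N³ |k|²` -/

section Energy

variable {ε : ℝ} (hε : 0 ≤ ε) (hε' : ε * ((N : ℝ) ^ 2 - N) ≤ 1 / 2)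
include hε hε'

omit hε hε' in
/-- Derivative of the witness density: `Dg = -ε · 2⟪ρ_m, Dρ_m⟫_ℝ`. [folklore] -/
theorem hasFDerivAt_witnessDensity (L : ℝ) (m : Fin 3 → ℤ) (X : Config N) :
    HasFDerivAt (witnessDensity (N := N) ε L m)
      (-(ε • (2 • ((innerSL ℝ (planeWaveSum (M := N) L m X)).comp
        (fderiv ℝ (planeWaveSum (M := N) L m) X))))) X := by
  have hρ : HasFDerivAt (planeWaveSum (M := N) L m) (fderiv ℝ (planeWaveSum (M := N) L m) X) X :=
    (((contDiff_planeWaveSum L m).differentiable (by simp)) X).hasFDerivAt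
  exact ((hρ.norm_sq.sub_const (N : ℝ)).const_mul ε).const_sub 1

omit hε hε' in
/-- `|∂_{i,a} ρ_m| = |2π mₐ / L|`. [folklore] -/
theorem norm_fderiv_planeWaveSum_single (L : ℝ) (m : Fin 3 → ℤ) (X : Config N) (i : Fin N)
    (a : Fin 3) :
    ‖fderiv ℝ (planeWaveSum (M := N) L m) X (Pi.single i (EuclideanSpace.single a 1))‖ =
      |2 * Real.pi * (m a) / L| := by
  rw [fderiv_planeWaveSum_apply_single, norm_mul, norm_cellWave, mul_one,
    show (2 * Real.pi * Complex.I * (m a) / L : ℂ) = ((2 * Real.pi * (m a) / L : ℝ) : ℂ) * Complex.I by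
      push_cast; ring, norm_mul, Complex.norm_I, mul_one, Complex.norm_real, Real.norm_eq_abs]

/-- **Pointwise bound on the partial derivatives of the witness state**:
`|∂_{i,a} Ψ_ε|² ≤ 2 (L³)^{-N} ε² N² (2π mₐ/L)²` (from `∂Ψ = c ∂g/(2√g)`, `|∂g| ≤ 2εN|∂ρ|`,
`g ≥ ½`). [folklore] -/
theorem norm_fderiv_witnessState_single_sq_le (hL : 0 < L) {m : Fin 3 → ℤ} (hm : m ≠ 0)
    (X : Config N) (i : Fin N) (a : Fin 3) :
    ‖fderiv ℝ (witnessState hε hε' hL hm).ψ X (Pi.single i (EuclideanSpace.single a 1))‖ ^ 2 ≤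
      2 * ((L ^ 3) ^ N)⁻¹ * ε ^ 2 * (N : ℝ) ^ 2 * (2 * Real.pi * (m a) / L) ^ 2 := by
  set c : ℂ := ((Real.sqrt ((L ^ 3) ^ N))⁻¹ : ℂ) with hc
  set g := witnessDensity (N := N) ε L m with hg
  set ρf := planeWaveSum (M := N) L m with hρf
  set g' : Config N →L[ℝ] ℝ := -(ε • (2 • ((innerSL ℝ (ρf X)).comp (fderiv ℝ ρf X))))
    with hg'
  have hgX : 0 < g X := witnessDensity_pos hε hε' L m X
  have hD : HasFDerivAt g g' X := hasFDerivAt_witnessDensity L m X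
  have hS : HasFDerivAt (fun Y => Real.sqrt (g Y)) ((1 / (2 * Real.sqrt (g X))) • g') X :=
    hD.sqrt hgX.ne'
  have hF : HasFDerivAt (fun Y => ((Real.sqrt (g Y) : ℝ) : ℂ))
      (Complex.ofRealCLM.comp ((1 / (2 * Real.sqrt (g X))) • g')) X :=
    Complex.ofRealCLM.hasFDerivAt.comp X hS
  have hfun : (witnessState hε hε' hL hm).ψ = fun Y => c * ((Real.sqrt (g Y) : ℝ) : ℂ) :=
    funext fun Y => witnessState_apply hε hε' hL hm Y
  have hΨ := hF.const_mul c
  rw [hfun, hΨ.fderiv]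
  -- evaluate on the coordinate vector
  set v : Config N := Pi.single i (EuclideanSpace.single a 1) with hv
  have happ : (c • Complex.ofRealCLM.comp ((1 / (2 * Real.sqrt (g X))) • g')) v =
      c * (((1 / (2 * Real.sqrt (g X))) * g' v : ℝ) : ℂ) := by
    simp [smul_eq_mul]
  rw [happ, norm_mul, Complex.norm_real, Real.norm_eq_abs, abs_mul,
    abs_of_pos (by positivity : 0 < 1 / (2 * Real.sqrt (g X)))]
  -- |g' v| ≤ 2 ε N |∂ρ|
  have hg'v : |g' v| ≤ 2 * ε * N * |2 * Real.pi * (m a) / L| := by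
    have h1 : g' v = -(ε * (2 * inner ℝ (ρf X) (fderiv ℝ ρf X v))) := by
      simp only [hg', neg_apply, smul_apply,
        ContinuousLinearMap.comp_apply, innerSL_apply_apply, smul_eq_mul, nsmul_eq_mul,
        Nat.cast_ofNat]
    rw [h1, abs_neg, abs_mul, abs_of_nonneg hε, abs_mul, abs_of_pos (by norm_num : (0:ℝ) < 2)]
    have h2 := abs_real_inner_le_norm (ρf X) (fderiv ℝ ρf X v)
    rw [norm_fderiv_planeWaveSum_single] at h2
    have h3 : ‖ρf X‖ ≤ N := norm_planeWaveSum_le L m X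
    calc ε * (2 * |inner ℝ (ρf X) (fderiv ℝ ρf X v)|)
        ≤ ε * (2 * (‖ρf X‖ * |2 * Real.pi * (m a) / L|)) := by gcongr
      _ ≤ ε * (2 * (N * |2 * Real.pi * (m a) / L|)) := by gcongr
      _ = 2 * ε * N * |2 * Real.pi * (m a) / L| := by ring
  -- assemble: (‖c‖ · (1/(2√g)) · |g'v|)² ≤ ‖c‖² · (1/(4g)) · 4ε²N²(∂ρ)² ≤ 2‖c‖²ε²N²(∂ρ)²
  have hcn : ‖c‖ ^ 2 = ((L ^ 3) ^ N)⁻¹ := by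
    rw [hc, norm_inv, Complex.norm_real, Real.norm_of_nonneg (Real.sqrt_nonneg _), inv_pow,
      Real.sq_sqrt (by positivity)]
  have hhalf : 1 / 2 ≤ g X := half_le_witnessDensity hε hε' L m X
  have hsq : (1 / (2 * Real.sqrt (g X))) ^ 2 = 1 / (4 * g X) := by
    rw [div_pow, mul_pow, Real.sq_sqrt hgX.le]; norm_num
  have hb : 0 ≤ |g' v| := abs_nonneg _
  calc (‖c‖ * (1 / (2 * Real.sqrt (g X)) * |g' v|)) ^ 2
      = ‖c‖ ^ 2 * (1 / (4 * g X)) * |g' v| ^ 2 := by rw [mul_pow, mul_pow, hsq]; ring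
    _ ≤ ‖c‖ ^ 2 * (1 / (4 * g X)) * (2 * ε * N * |2 * Real.pi * (m a) / L|) ^ 2 := by
        gcongr
    _ ≤ ‖c‖ ^ 2 * (1 / 2) * (2 * ε * N * |2 * Real.pi * (m a) / L|) ^ 2 := by
        gcongr ‖c‖ ^ 2 * ?_ * _
        rw [div_le_iff₀ (by positivity)]
        linarith
    _ = 2 * ((L ^ 3) ^ N)⁻¹ * ε ^ 2 * (N : ℝ) ^ 2 * (2 * Real.pi * (m a) / L) ^ 2 := by
        rw [hcn, mul_pow, mul_pow, mul_pow, sq_abs]; ring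

omit hε hε' in
/-- `∑ₐ (2π mₐ/L)² = |k|²` with `kn m = ‖(2π/L) • latticeVec 1 m‖`. [folklore] -/
theorem sum_sq_eq_norm_sq (L : ℝ) (m : Fin 3 → ℤ) :
    ∑ a : Fin 3, (2 * Real.pi * (m a) / L) ^ 2 = ‖((2 * Real.pi / L) • latticeVec 1 m)‖ ^ 2 := by
  rw [EuclideanSpace.real_norm_sq_eq]
  refine Finset.sum_congr rfl fun a _ => ?_
  simp only [latticeVec, PiLp.smul_apply, smul_eq_mul, one_mul]
  ring

/-- **Kinetic energy of the witness**: `periodicEnergy 0 Ψ_ε ≤ 2 ε² N³ |k|²` (the interaction is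
absent for `v ≡ 0`; pointwise `|∇Ψ_ε|² ≤ 2(L³)^{-N}ε²N³|k|²`, cell volume `(L³)ᴺ`). [folklore] -/
theorem periodicEnergy_witnessState_le (hL : 0 < L) {m : Fin 3 → ℤ} (hm : m ≠ 0) :
    periodicEnergy (0 : ℝ → ℝ≥0∞) (witnessState hε hε' hL hm) ≤
      ENNReal.ofReal (2 * ε ^ 2 * (N : ℝ) ^ 3 * ‖((2 * Real.pi / L) • latticeVec 1 m)‖ ^ 2) := by
  set B : ℝ := 2 * ((L ^ 3) ^ N)⁻¹ * ε ^ 2 * (N : ℝ) ^ 3 * ‖((2 * Real.pi / L) • latticeVec 1 m)‖ ^ 2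
    with hB
  have hpt : ∀ X : Config N, kineticDensity (witnessState hε hε' hL hm).ψ X ≤ ENNReal.ofReal B := by
    intro X
    unfold kineticDensity
    calc ∑ i : Fin N, ∑ a : Fin 3, ((‖fderiv ℝ (witnessState hε hε' hL hm).ψ X
          (Pi.single i (EuclideanSpace.single a 1))‖₊ : ℝ≥0∞)) ^ 2
        ≤ ∑ _i : Fin N, ∑ a : Fin 3, ENNReal.ofReal
            (2 * ((L ^ 3) ^ N)⁻¹ * ε ^ 2 * (N : ℝ) ^ 2 * (2 * Real.pi * (m a) / L) ^ 2) := by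
          gcongr with i _ a _
          rw [coe_nnnorm_sq_eq_ofReal]
          exact ENNReal.ofReal_le_ofReal
            (norm_fderiv_witnessState_single_sq_le hε hε' hL hm X i a)
      _ = ENNReal.ofReal B := by
          rw [← ENNReal.ofReal_sum_of_nonneg (fun a _ => by positivity), ← Finset.mul_sum,
            sum_sq_eq_norm_sq, Finset.sum_const, Finset.card_univ, Fintype.card_fin,
            nsmul_eq_mul, ← ENNReal.ofReal_natCast, ← ENNReal.ofReal_mul (Nat.cast_nonneg _), hB]
          congr 1
          ring
  calc periodicEnergy (0 : ℝ → ℝ≥0∞) (witnessState hε hε' hL hm)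
      = ∫⁻ X in cellN N L, kineticDensity (witnessState hε hε' hL hm).ψ X := by
        rw [periodicEnergy]
        refine lintegral_congr fun X => ?_
        rw [periodicInteraction_zeroPotential, zero_mul, add_zero]
    _ ≤ ∫⁻ _ in cellN N L, ENNReal.ofReal B := lintegral_mono fun X => hpt X
    _ = ENNReal.ofReal B * ((ENNReal.ofReal L ^ 3) ^ N) := by rw [setLIntegral_const, volume_cellN]
    _ = ENNReal.ofReal (2 * ε ^ 2 * (N : ℝ) ^ 3 * ‖((2 * Real.pi / L) • latticeVec 1 m)‖ ^ 2) := by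
        rw [← ENNReal.ofReal_pow hL.le, ← ENNReal.ofReal_pow (by positivity),
          ← ENNReal.ofReal_mul (by positivity), hB]
        congr 1
        have hV : (0 : ℝ) < (L ^ 3) ^ N := by positivity
        field_simp

end Energy

end Summit.AtomisticToContinuum.BoseEinsteinCondensation.Theorems.PuffFloor.Negative

end
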